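/-
Copyright (c) 2026 the pub-hodgecm-mathlib formalisation cell (harness21).  Prover seat hodgecm-mathlib-K2E3-p21 (g4), Track B «K2-LIT» ∕ h413
(`stmt-HodgeConjecture-24833`), line `K2_E3_EllipticInputs`, unit U12 §L, Richardson road for (LBGL-ge3) at `N = 3`, (F-E) ROAD v2 brick EXHAUST (road owner K2E3-p11 (g5),
06:00:55Z (4)): «FIBRE EXHAUSTION — if `Ad(k) P` is `𝔭^J`-close to a block-regular `M(m)` (`χ_A` without roots in `F`) then `k ∈ GL₃(𝒪)` is `𝔭^{J−c}`-close to `P_{(2,1)}`».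
2026-09-04.
-/
import Summits.HodgeConjecture.HodgeConjecture.Theorems.K2E3GLnLieAdIntegralInvariant    -- ★ (K2E3-p11 g4): `glInt` ∕ `primePowBall` kits (`mem_glInt_iff`, `mem_primePowBall_iff`, `add_mem_primePowBall`, …)
import Literature.NumberTheory.Automorphic.LocalFieldHaarBalls                         -- ★ `continuous_normAbs`, `normAbs_add_eq_of_lt`, `isCompact_primePowBall`
import Literature.NumberTheory.Automorphic.LocalPiSchwartzBruhatFourier                -- ★ `sum_mem_primePowBall`
import HarnessLib

/-!
# K2_E3 road (h413), §L — Richardson road for (LBGL-ge3) at `N = 3`, (F-E) ROAD v2 brick EXHAUST: the fibres of `K × 𝔭 → 𝔤`, `(k, P) ↦ Ad(k) P`, near a Levi centre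
# (a) `Ad(k) P ∈ M(m) + M₃(𝔭^J)`, `χ_A` rootless ⇒ `k₂₀, k₂₁ ∈ 𝔭^{J−c}`;  (b) `Ad(k) P ∈ diag(d) + M₃(𝔭^J)`, `d` injective ⇒ `∃ a, k_{a0}, k_{a1} ∈ 𝔭^{J−c}`

Cell `pub/hodgecm-mathlib` (D-0151), Track B, seat K2E3-p21 (g4); road owner K2E3-p11 (g5) (06:00:55Z (4): «EXHAUST `Theorems/K2E3GL3ParabolicFibreExhaustion.lean` — NEXT FREE HAND
(p21 after A′2 …; M, pure valuation algebra, no measure theory): (a) `exists_level_of_conj_mem_box_of_forall_eval_ne_zero` … (b) `exists_level_of_conj_mem_box_diagonal` …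
PROOF (both): `w := row 2 of ↑k⁻¹` …»), §L lead K2E3-p12 (g5), dealer K2E3-plan (g3).  `--supports stmt-HodgeConjecture-24833 --as helper`; THEOREMS ONLY (no definition ∕
instance ∕ notation ∕ named fact ∕ `sorry`); never imports `Cruxes/…/Lines`.  COUNT-NEUTRAL ((LBGL-ge3) stays OPEN).

THE MATHEMATICS (`N = |·|_F = normAbs F`, `ρ = q⁻¹`, `𝔭^J = {N ≤ ρ^J}`).  Let `k ∈ K = GL₃(𝒪)` (entries of `k`, `k⁻¹` in `𝒪`), `P ∈ 𝔭 = 𝔭_{(2,1)}` (`P₂₀ = P₂₁ = 0`),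
`X = k P k⁻¹` and `w =` row 2 of `k⁻¹`.  §1: (I) `w X = P₂₂ w` (as `k⁻¹ X = P k⁻¹` and row 2 of `P` is `P₂₂ e₂`); (III) `w` has a unit entry (`Σ_i w_i k_{i2} = 1`);
(IV) `Σ_i w_i k_{il} = 0` for `l = 0, 1`; every bound `B` is `≤ ρ^{-c}` for some `c ∈ ℕ`.  §2 (a): if `X − M(m) ∈ M₃(𝔭^J)`, `M(m) = [[A,0],[0,m₄]]`, then with `t = P₂₂`:
`(w₀,w₁)(A − t) ∈ (𝔭^J)²` and `N(t) ≤ B₁ = 1 + Σ N(mᵢ)` (unit entry), so by the `2×2` adjugate `N(w_l) N(χ_A(t)) ≤ ρ^J B₁` (`l = 0,1`); `χ_A` has no root in `F`, so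
`δ = min {N(χ_A(t)) : N(t) ≤ B₁} > 0` (compact ball, `continuous_normAbs`) and `w₀, w₁ ∈ 𝔭^{J−c}` once `ρ^{-c} ≥ B₁/δ`; for `J ≥ c + 1` the unit entry of `w` is then `w₂`,
and (IV) gives **`k₂₀, k₂₁ ∈ 𝔭^{J−c}`** — the fibre of `K × 𝔭 → 𝔤`, `(k,P) ↦ Ad(k)P`, over a `𝔭^J`-neighbourhood of a block-regular `M(m)` with `χ_A` rootless lies
within `𝔭^{J−c}` of `K ∩ P`.  §3 (b): for `M₀ = diag(d)`, `d` injective, `w_j(d_j − t) ∈ 𝔭^J`; at the unit index `a`, `N(d_a − t) ≤ ρ^J < γ = min_{i≠j} N(d_i − d_j)` for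
`J ≥ c + 1` (`ρ^c ≤ γ`), so `N(d_i − t) = N(d_i − d_a) ≥ γ` and `w_i ∈ 𝔭^{J−c}` for `i ≠ a`, and (IV) on row `a` gives **`k_{a0}, k_{a1} ∈ 𝔭^{J−c}`**.
[HarishChandra1999AdmissibleDistributions, §7 Lemma 7.8 (parabolic descent: properness of the fibres)]; [BushnellHenniart2006, §1.1 (`𝔭^m`)].

HONEST LABEL: HC_CM is proved only modulo the 7 printed citations (2 remaining named inputs: hLiu418 = stmt-HodgeConjecture-24832, h413 = stmt-HodgeConjecture-24833)
until rung 0 closes; count-neutral helper.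
-/

set_option autoImplicit false
set_option linter.dupNamespace false   -- `Summit.HodgeConjecture.HodgeConjecture.…` (D-0017 nested layout; lakefile exemption for Summits)

noncomputable section

open Filter Topology TopologicalSpace Polynomial Function
open scoped MatrixGroups NNReal
open Literature.NumberTheory.Automorphic Literature.NumberTheory.Automorphic.LocalFieldHaar
open Literature.NumberTheory.GaloisRepresentations Literature.NumberTheory.GaloisRepresentations.IsNonarchimedeanLocalField

namespace Summit.HodgeConjecture.HodgeConjecture.Cruxes.H413.K2E3GL3ParabolicFibreExhaustion

variable {F : Type*} [Field F] [ValuativeRel F] [TopologicalSpace F] [IsNonarchimedeanLocalField F]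

/-! ## §1  Common lemmas: integral entries, the row `w = e₂ k⁻¹`, `w X = P₂₂ w`, the unit entry of `w`, the column relations, `ρ`-powers -/

/-- Entries of `k ∈ GL₃(𝒪)` and of `k⁻¹` have `|·|_F ≤ 1`. [cite: BushnellHenniart2006, §1.1] -/
theorem normAbs_apply_le_one_of_mem_glInt {n : ℕ} {k : GL (Fin n) F} (hk : k ∈ glInt n F) (i j : Fin n) :
    normAbs F ((k : Matrix (Fin n) (Fin n) F) i j) ≤ 1 ∧ normAbs F (((k⁻¹ : GL (Fin n) F) : Matrix (Fin n) (Fin n) F) i j) ≤ 1 := by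
  obtain ⟨h1, h2⟩ := (mem_glInt_iff k).1 hk
  exact ⟨normAbs_le_one_iff.2 (h1 i j), normAbs_le_one_iff.2 (h2 i j)⟩

/-- Every `B ≥ 0` is `≤ ρ^{-c} = q^c` for some `c ∈ ℕ` (`q > 1`). [folklore] -/
theorem exists_le_zpow_neg (B : ℝ≥0) : ∃ c : ℕ, B ≤ ((residueFieldCard F : ℝ≥0)⁻¹) ^ (-(c : ℤ)) := by
  obtain ⟨n, hn⟩ := pow_unbounded_of_one_lt B (one_lt_residueFieldCard_nnreal (F := F))
  refine ⟨n, ?_⟩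
  rw [zpow_neg, zpow_natCast, inv_pow, inv_inv]
  exact hn.le

omit [ValuativeRel F] [TopologicalSpace F] [IsNonarchimedeanLocalField F] in
/-- **(I) `w X = P₂₂ w`**: for `X = k P k⁻¹` with `P₂₀ = P₂₁ = 0` and `w` the last row of `k⁻¹`, `Σ_i w_i X_{ij} = P₂₂ w_j`. [folklore] -/
theorem sum_invRow_mul_conj_eq (k : GL (Fin 3) F) {P : Matrix (Fin 3) (Fin 3) F} (hP20 : P 2 0 = 0) (hP21 : P 2 1 = 0) (j : Fin 3) :
    ∑ i : Fin 3, ((k⁻¹ : GL (Fin 3) F) : Matrix (Fin 3) (Fin 3) F) 2 i * ((k : Matrix (Fin 3) (Fin 3) F) * P * ((k⁻¹ : GL (Fin 3) F) : Matrix (Fin 3) (Fin 3) F)) i j =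
      P 2 2 * ((k⁻¹ : GL (Fin 3) F) : Matrix (Fin 3) (Fin 3) F) 2 j := by
  have h : (((k⁻¹ : GL (Fin 3) F) : Matrix (Fin 3) (Fin 3) F) * ((k : Matrix (Fin 3) (Fin 3) F) * P * ((k⁻¹ : GL (Fin 3) F) : Matrix (Fin 3) (Fin 3) F))) 2 j =
      (P * ((k⁻¹ : GL (Fin 3) F) : Matrix (Fin 3) (Fin 3) F)) 2 j := by
    have hkk : ((k⁻¹ : GL (Fin 3) F) : Matrix (Fin 3) (Fin 3) F) * (k : Matrix (Fin 3) (Fin 3) F) = 1 := k.inv_mul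
    rw [← Matrix.mul_assoc, ← Matrix.mul_assoc, hkk, Matrix.one_mul]
  rw [Matrix.mul_apply] at h
  rw [h, Matrix.mul_apply, Fin.sum_univ_three, hP20, hP21, zero_mul, zero_mul, zero_add, zero_add]

/-- **(III) the last row of `k⁻¹` has a unit entry** (`k ∈ GL₃(𝒪)`): `∃ a, |(k⁻¹)₂ₐ| = 1` (from `Σ_i (k⁻¹)₂ᵢ k_{i2} = 1` and `|·| ≤ 1`). [cite: BushnellHenniart2006, §1.1] -/
theorem exists_normAbs_invRow_eq_one {k : GL (Fin 3) F} (hk : k ∈ glInt 3 F) :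
    ∃ a : Fin 3, normAbs F (((k⁻¹ : GL (Fin 3) F) : Matrix (Fin 3) (Fin 3) F) 2 a) = 1 := by
  by_contra hne
  push Not at hne
  have hlt : ∀ a : Fin 3, normAbs F (((k⁻¹ : GL (Fin 3) F) : Matrix (Fin 3) (Fin 3) F) 2 a) < 1 := fun a =>
    lt_of_le_of_ne (normAbs_apply_le_one_of_mem_glInt hk 2 a).2 (hne a)
  have h1 : ∑ i : Fin 3, ((k⁻¹ : GL (Fin 3) F) : Matrix (Fin 3) (Fin 3) F) 2 i * (k : Matrix (Fin 3) (Fin 3) F) i 2 = 1 := by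
    have h := congrFun (congrFun (k.inv_mul : ((k⁻¹ : GL (Fin 3) F) : Matrix (Fin 3) (Fin 3) F) * (k : Matrix (Fin 3) (Fin 3) F) = 1) 2) 2
    rwa [Matrix.mul_apply, Matrix.one_apply_eq] at h
  have hterm : ∀ i : Fin 3, normAbs F (((k⁻¹ : GL (Fin 3) F) : Matrix (Fin 3) (Fin 3) F) 2 i * (k : Matrix (Fin 3) (Fin 3) F) i 2) < 1 := fun i => by
    rw [map_mul]
    calc normAbs F (((k⁻¹ : GL (Fin 3) F) : Matrix (Fin 3) (Fin 3) F) 2 i) * normAbs F ((k : Matrix (Fin 3) (Fin 3) F) i 2)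
        ≤ normAbs F (((k⁻¹ : GL (Fin 3) F) : Matrix (Fin 3) (Fin 3) F) 2 i) * 1 := mul_le_mul_of_nonneg_left (normAbs_apply_le_one_of_mem_glInt hk i 2).1 zero_le
      _ < 1 := by rw [mul_one]; exact hlt i
  have hsum : normAbs F (∑ i : Fin 3, ((k⁻¹ : GL (Fin 3) F) : Matrix (Fin 3) (Fin 3) F) 2 i * (k : Matrix (Fin 3) (Fin 3) F) i 2) < 1 := by
    rw [Fin.sum_univ_three]
    refine lt_of_le_of_lt (normAbs_add_le_max _ _) (max_lt (lt_of_le_of_lt (normAbs_add_le_max _ _) (max_lt (hterm 0) (hterm 1))) (hterm 2))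
  rw [h1, map_one] at hsum
  exact lt_irrefl _ hsum

omit [ValuativeRel F] [TopologicalSpace F] [IsNonarchimedeanLocalField F] in
/-- **(IV) the column relations**: `Σ_i (k⁻¹)₂ᵢ k_{il} = 0` for `l ≠ 2`. [folklore] -/
theorem sum_invRow_mul_col_eq_zero (k : GL (Fin 3) F) {l : Fin 3} (hl : l ≠ 2) :
    ∑ i : Fin 3, ((k⁻¹ : GL (Fin 3) F) : Matrix (Fin 3) (Fin 3) F) 2 i * (k : Matrix (Fin 3) (Fin 3) F) i l = 0 := by
  have h := congrFun (congrFun (k.inv_mul : ((k⁻¹ : GL (Fin 3) F) : Matrix (Fin 3) (Fin 3) F) * (k : Matrix (Fin 3) (Fin 3) F) = 1) 2) l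
  rwa [Matrix.mul_apply, Matrix.one_apply_ne' hl] at h

/-- **(II) the perturbed eigen-relation**: if moreover `X − M₀ ∈ M₃(𝔭^J)` then `Σ_i w_i (M₀)_{ij} − P₂₂ w_j ∈ 𝔭^J` for every `j`. [cite: BushnellHenniart2006, §1.1] -/
theorem sum_invRow_mul_sub_mem_primePowBall {k : GL (Fin 3) F} (hk : k ∈ glInt 3 F) {P : Matrix (Fin 3) (Fin 3) F} (hP20 : P 2 0 = 0) (hP21 : P 2 1 = 0)
    (M₀ : Matrix (Fin 3) (Fin 3) F) {J : ℤ}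
    (hX : ∀ i l, ((k : Matrix (Fin 3) (Fin 3) F) * P * ((k⁻¹ : GL (Fin 3) F) : Matrix (Fin 3) (Fin 3) F) - M₀) i l ∈ primePowBall F J) (j : Fin 3) :
    ∑ i : Fin 3, ((k⁻¹ : GL (Fin 3) F) : Matrix (Fin 3) (Fin 3) F) 2 i * M₀ i j - P 2 2 * ((k⁻¹ : GL (Fin 3) F) : Matrix (Fin 3) (Fin 3) F) 2 j ∈ primePowBall F J := by
  have hI := sum_invRow_mul_conj_eq k hP20 hP21 j
  have heq : ∑ i : Fin 3, ((k⁻¹ : GL (Fin 3) F) : Matrix (Fin 3) (Fin 3) F) 2 i * M₀ i j - P 2 2 * ((k⁻¹ : GL (Fin 3) F) : Matrix (Fin 3) (Fin 3) F) 2 j =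
      -∑ i : Fin 3, ((k⁻¹ : GL (Fin 3) F) : Matrix (Fin 3) (Fin 3) F) 2 i *
        ((k : Matrix (Fin 3) (Fin 3) F) * P * ((k⁻¹ : GL (Fin 3) F) : Matrix (Fin 3) (Fin 3) F) - M₀) i j := by
    rw [← hI]
    simp only [Matrix.sub_apply, mul_sub, Finset.sum_sub_distrib]
    ring
  rw [heq]
  refine neg_mem_primePowBall (sum_mem_primePowBall _ fun i _ => ?_)
  have h := mul_mem_primePowBall ((mem_primePowBall_iff).2 ((zpow_zero ((residueFieldCard F : ℝ≥0)⁻¹)).symm ▸ (normAbs_apply_le_one_of_mem_glInt hk 2 i).2)) (hX i j)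
  rwa [zero_add] at h

/-- `χ_{[[a,b],[c,d]]}(t) = (t − a)(t − d) − b c`. [folklore] -/
theorem eval_charpoly_two {R : Type*} [CommRing R] (a b c d t : R) :
    (!![a, b; c, d] : Matrix (Fin 2) (Fin 2) R).charpoly.eval t = (t - a) * (t - d) - b * c := by
  rw [Matrix.eval_charpoly, Matrix.det_fin_two]
  simp [Matrix.scalar_apply, Matrix.diagonal]

/-! ## §2  Part (a): block-regular centre `M(m)` with `χ_A` rootless in `F` -/

/-- **EXHAUST (a).**  Let `M(m) = [[m₀,m₁,0],[m₂,m₃,0],[0,0,m₄]]` with `χ_A(t) ≠ 0` for all `t ∈ F` (`A = [[m₀,m₁],[m₂,m₃]]`).  There are `c, J₀ ∈ ℤ` such that for all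
`J ≥ J₀`, all `k ∈ GL₃(𝒪)` and all `P` with `P₂₀ = P₂₁ = 0`: if `k P k⁻¹ − M(m) ∈ M₃(𝔭^J)` entrywise then **`k₂₀, k₂₁ ∈ 𝔭^{J−c}`** — `k` is `𝔭^{J−c}`-close to
`P_{(2,1)}`.  (`w =` row 2 of `k⁻¹`: `(w₀,w₁)(A − P₂₂) ∈ (𝔭^J)²`, adjugate and `min_{|t| ≤ B} |χ_A(t)| > 0` give `w₀, w₁ ∈ 𝔭^{J−c}`, so `w₂` is the unit entry and
`k₂ₗ = −w₂⁻¹(w₀k₀ₗ + w₁k₁ₗ)`.) [cite: HarishChandra1999AdmissibleDistributions, §7 Lemma 7.8] [cite: BushnellHenniart2006, §1.1] -/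
theorem exists_level_of_conj_mem_box_of_forall_eval_ne_zero (m : Fin 5 → F)
    (hA : ∀ t : F, (!![m 0, m 1; m 2, m 3] : Matrix (Fin 2) (Fin 2) F).charpoly.eval t ≠ 0) :
    ∃ c J₀ : ℤ, ∀ J : ℤ, J₀ ≤ J → ∀ k : GL (Fin 3) F, k ∈ glInt 3 F → ∀ P : Matrix (Fin 3) (Fin 3) F, P 2 0 = 0 → P 2 1 = 0 →
      (∀ i l, ((k : Matrix (Fin 3) (Fin 3) F) * P * ((k⁻¹ : GL (Fin 3) F) : Matrix (Fin 3) (Fin 3) F) - !![m 0, m 1, 0; m 2, m 3, 0; 0, 0, m 4]) i l ∈ primePowBall F J) →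
        (k : Matrix (Fin 3) (Fin 3) F) 2 0 ∈ primePowBall F (J - c) ∧ (k : Matrix (Fin 3) (Fin 3) F) 2 1 ∈ primePowBall F (J - c) := by
  classical
  haveI : T2Space F := (isLocalField F).toT2Space
  -- notation: `N`, `ρ`
  set ρ : ℝ≥0 := (residueFieldCard F : ℝ≥0)⁻¹ with hρ
  have hρ0 : 0 < ρ := inv_residueFieldCard_pos
  have hρ1 : ρ < 1 := inv_residueFieldCard_lt_one
  -- the bound `B₁` on the entries of `M(m)` and on `t = P₂₂`
  set B₁ : ℝ≥0 := 1 + ∑ i : Fin 5, normAbs F (m i) with hB₁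
  have hmB : ∀ i : Fin 5, normAbs F (m i) ≤ B₁ := fun i =>
    (Finset.single_le_sum (f := fun i : Fin 5 => normAbs F (m i)) (fun _ _ => zero_le) (Finset.mem_univ i)).trans le_add_self
  have h1B : 1 ≤ B₁ := le_self_add
  -- `δ = min {N(χ_A(t)) : N(t) ≤ B₁} > 0`
  set χ : F → F := fun t => (t - m 0) * (t - m 3) - m 1 * m 2 with hχdef
  have hχ : ∀ t, (!![m 0, m 1; m 2, m 3] : Matrix (Fin 2) (Fin 2) F).charpoly.eval t = χ t := fun t => eval_charpoly_two _ _ _ _ t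
  have hχc : Continuous fun t => normAbs F (χ t) := continuous_normAbs.comp (by simp only [hχdef]; fun_prop)
  obtain ⟨c₁, hc₁⟩ := exists_le_zpow_neg (F := F) B₁
  have hS : IsCompact {t : F | normAbs F t ≤ B₁} :=
    (isCompact_primePowBall (-(c₁ : ℤ))).of_isClosed_subset (isClosed_le continuous_normAbs continuous_const) fun t ht => (mem_primePowBall_iff).2 (le_trans ht hc₁)
  obtain ⟨t₀, -, ht₀⟩ := hS.exists_isMinOn ⟨0, by simp⟩ hχc.continuousOn
  set δ : ℝ≥0 := normAbs F (χ t₀) with hδdef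
  have hδ0 : 0 < δ := pos_iff_ne_zero.2 fun h => hA t₀ (by rw [hχ]; exact (map_eq_zero (normAbs F)).1 h)
  have hδmin : ∀ t : F, normAbs F t ≤ B₁ → δ ≤ normAbs F (χ t) := fun t ht => ht₀ ht
  -- the level shift `c`: `B₁ / δ ≤ ρ^{-c}`
  obtain ⟨c, hc⟩ := exists_le_zpow_neg (F := F) (B₁ / δ)
  refine ⟨(c : ℤ), (c : ℤ) + 1, fun J hJ k hk P hP20 hP21 hX => ?_⟩
  have hJ0 : 0 ≤ J := by omega
  have hρJ1 : ρ ^ J ≤ 1 := zpow_le_one₀ hρ0 hρ1.le hJ0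
  -- the row `w` of `k⁻¹`, the entries `K` of `k`, `t = P₂₂`
  set Q : Matrix (Fin 3) (Fin 3) F := ((k⁻¹ : GL (Fin 3) F) : Matrix (Fin 3) (Fin 3) F) with hQ
  set K : Matrix (Fin 3) (Fin 3) F := (k : Matrix (Fin 3) (Fin 3) F) with hK
  set t : F := P 2 2 with ht
  have hw1 : ∀ i, normAbs F (Q 2 i) ≤ 1 := fun i => (normAbs_apply_le_one_of_mem_glInt hk 2 i).2
  have hK1 : ∀ i j, normAbs F (K i j) ≤ 1 := fun i j => (normAbs_apply_le_one_of_mem_glInt hk i j).1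
  -- (II) at `j = 0, 1, 2`
  have hII := sum_invRow_mul_sub_mem_primePowBall hk hP20 hP21 _ hX
  have hv0 : Q 2 0 * (m 0 - t) + Q 2 1 * m 2 ∈ primePowBall F J := by
    have h := hII 0
    simp only [Fin.sum_univ_three, Matrix.of_apply, Matrix.cons_val', Matrix.cons_val_zero, Matrix.cons_val_one, Matrix.cons_val_two, Matrix.cons_val_fin_one,
      Matrix.empty_val', Matrix.tail_cons, Matrix.head_fin_const] at h
    convert h using 1
    ring
  have hv1 : Q 2 0 * m 1 + Q 2 1 * (m 3 - t) ∈ primePowBall F J := by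
    have h := hII 1
    simp only [Fin.sum_univ_three, Matrix.of_apply, Matrix.cons_val', Matrix.cons_val_zero, Matrix.cons_val_one, Matrix.cons_val_two, Matrix.cons_val_fin_one,
      Matrix.empty_val', Matrix.tail_cons, Matrix.head_fin_const] at h
    convert h using 1
    ring
  -- the bound `N(t) ≤ B₁`: at the unit index `a`, `t w_a = Σ_i w_i M_{ia} − (…∈ 𝔭^J)`
  obtain ⟨a, ha⟩ := exists_normAbs_invRow_eq_one hk
  have hMb : ∀ i j : Fin 3, normAbs F ((!![m 0, m 1, 0; m 2, m 3, 0; 0, 0, m 4] : Matrix (Fin 3) (Fin 3) F) i j) ≤ B₁ := fun i j => by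
    fin_cases i <;> fin_cases j <;> simp [hmB]
  have htB : normAbs F t ≤ B₁ := by
    have h := hII a
    -- `t * w_a = S - v` with `N(S) ≤ B₁`, `N(v) ≤ ρ^J ≤ 1 ≤ B₁`
    have hS : normAbs F (∑ i : Fin 3, Q 2 i * (!![m 0, m 1, 0; m 2, m 3, 0; 0, 0, m 4] : Matrix (Fin 3) (Fin 3) F) i a) ≤ B₁ := by
      have hterm : ∀ i : Fin 3, normAbs F (Q 2 i * (!![m 0, m 1, 0; m 2, m 3, 0; 0, 0, m 4] : Matrix (Fin 3) (Fin 3) F) i a) ≤ B₁ := fun i => by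
        rw [map_mul]
        calc normAbs F (Q 2 i) * normAbs F ((!![m 0, m 1, 0; m 2, m 3, 0; 0, 0, m 4] : Matrix (Fin 3) (Fin 3) F) i a) ≤ 1 * B₁ :=
              mul_le_mul (hw1 i) (hMb i a) zero_le zero_le
          _ = B₁ := one_mul _
      rw [Fin.sum_univ_three]
      exact (normAbs_add_le_max _ _).trans (max_le ((normAbs_add_le_max _ _).trans (max_le (hterm 0) (hterm 1))) (hterm 2))
    have hta : t * Q 2 a = ∑ i : Fin 3, Q 2 i * (!![m 0, m 1, 0; m 2, m 3, 0; 0, 0, m 4] : Matrix (Fin 3) (Fin 3) F) i a -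
        (∑ i : Fin 3, Q 2 i * (!![m 0, m 1, 0; m 2, m 3, 0; 0, 0, m 4] : Matrix (Fin 3) (Fin 3) F) i a - t * Q 2 a) := by ring
    have hN : normAbs F (t * Q 2 a) ≤ B₁ := by
      rw [hta, sub_eq_add_neg]
      refine (normAbs_add_le_max _ _).trans (max_le hS ?_)
      rw [normAbs_neg]
      exact ((mem_primePowBall_iff).1 h).trans (hρJ1.trans h1B)
    rwa [map_mul, ha, mul_one] at hN
  -- the adjugate: `w_l χ(t) = …`, so `N(w_l) δ ≤ ρ^J B₁`
  have hδt : δ ≤ normAbs F (χ t) := hδmin t htB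
  have hm3t : normAbs F (m 3 - t) ≤ B₁ := by
    rw [sub_eq_add_neg]; exact (normAbs_add_le_max _ _).trans (max_le (hmB 3) (by rw [normAbs_neg]; exact htB))
  have hm0t : normAbs F (m 0 - t) ≤ B₁ := by
    rw [sub_eq_add_neg]; exact (normAbs_add_le_max _ _).trans (max_le (hmB 0) (by rw [normAbs_neg]; exact htB))
  have hprod : ∀ {v x : F}, v ∈ primePowBall F J → normAbs F x ≤ B₁ → normAbs F (v * x) ≤ ρ ^ J * B₁ := fun hv hx => by
    rw [map_mul]; exact mul_le_mul ((mem_primePowBall_iff).1 hv) hx zero_le zero_le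
  have hw0 : normAbs F (Q 2 0) * δ ≤ ρ ^ J * B₁ := by
    have hid : Q 2 0 * χ t = (Q 2 0 * (m 0 - t) + Q 2 1 * m 2) * (m 3 - t) + -((Q 2 0 * m 1 + Q 2 1 * (m 3 - t)) * m 2) := by
      simp only [hχdef]; ring
    calc normAbs F (Q 2 0) * δ ≤ normAbs F (Q 2 0) * normAbs F (χ t) := mul_le_mul_of_nonneg_left hδt zero_le
      _ = normAbs F (Q 2 0 * χ t) := by rw [map_mul]
      _ ≤ ρ ^ J * B₁ := by
          rw [hid]
          refine (normAbs_add_le_max _ _).trans (max_le (hprod hv0 hm3t) ?_)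
          rw [normAbs_neg]
          exact hprod hv1 (hmB 2)
  have hw1' : normAbs F (Q 2 1) * δ ≤ ρ ^ J * B₁ := by
    have hid : Q 2 1 * χ t = -((Q 2 0 * (m 0 - t) + Q 2 1 * m 2) * m 1) + (Q 2 0 * m 1 + Q 2 1 * (m 3 - t)) * (m 0 - t) := by
      simp only [hχdef]; ring
    calc normAbs F (Q 2 1) * δ ≤ normAbs F (Q 2 1) * normAbs F (χ t) := mul_le_mul_of_nonneg_left hδt zero_le
      _ = normAbs F (Q 2 1 * χ t) := by rw [map_mul]
      _ ≤ ρ ^ J * B₁ := by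
          rw [hid]
          refine (normAbs_add_le_max _ _).trans (max_le ?_ (hprod hv1 hm0t))
          rw [normAbs_neg]
          exact hprod hv0 (hmB 1)
  -- hence `N(w_l) ≤ ρ^{J-c}` (`l = 0, 1`)
  have hρJc : ρ ^ J * B₁ / δ ≤ ρ ^ (J - c) :=
    calc ρ ^ J * B₁ / δ = ρ ^ J * (B₁ / δ) := mul_div_assoc _ _ _
      _ ≤ ρ ^ J * ρ ^ (-(c : ℤ)) := mul_le_mul_of_nonneg_left hc zero_le
      _ = ρ ^ (J - c) := by rw [← zpow_add₀ hρ0.ne', ← sub_eq_add_neg]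
  have hwl : ∀ {x : F}, normAbs F x * δ ≤ ρ ^ J * B₁ → normAbs F x ≤ ρ ^ (J - c) := fun h => ((le_div_iff₀ hδ0).2 h).trans hρJc
  have hq0 : normAbs F (Q 2 0) ≤ ρ ^ (J - c) := hwl hw0
  have hq1 : normAbs F (Q 2 1) ≤ ρ ^ (J - c) := hwl hw1'
  -- for `J ≥ c + 1`, `ρ^{J-c} < 1`, so the unit entry of `w` is `w₂`
  have hlt1 : ρ ^ (J - c) < 1 := zpow_lt_one₀ hρ0 hρ1 (by omega)
  have ha2 : normAbs F (Q 2 2) = 1 := by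
    fin_cases a
    · exact absurd ha (ne_of_lt (hq0.trans_lt hlt1))
    · exact absurd ha (ne_of_lt (hq1.trans_lt hlt1))
    · exact ha
  -- (IV): `w₂ k₂ₗ = −(w₀ k₀ₗ + w₁ k₁ₗ)`
  have hcol : ∀ l : Fin 3, l ≠ 2 → normAbs F (K 2 l) ≤ ρ ^ (J - c) := fun l hl => by
    have h := sum_invRow_mul_col_eq_zero k hl
    rw [Fin.sum_univ_three] at h
    have h2 : Q 2 2 * K 2 l = -(Q 2 0 * K 0 l + Q 2 1 * K 1 l) := by
      rw [eq_neg_iff_add_eq_zero, add_comm]; exact h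
    have hN : normAbs F (Q 2 2 * K 2 l) ≤ ρ ^ (J - c) := by
      rw [h2, normAbs_neg]
      refine (normAbs_add_le_max _ _).trans (max_le ?_ ?_)
      · rw [map_mul]; exact (mul_le_mul hq0 (hK1 0 l) zero_le zero_le).trans_eq (mul_one _)
      · rw [map_mul]; exact (mul_le_mul hq1 (hK1 1 l) zero_le zero_le).trans_eq (mul_one _)
    rwa [map_mul, ha2, one_mul] at hN
  exact ⟨(mem_primePowBall_iff).2 (hcol 0 (by decide)), (mem_primePowBall_iff).2 (hcol 1 (by decide))⟩

/-! ## §3  Part (b): regular diagonal centre `diag(d)` -/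

/-- **EXHAUST (b).**  Let `d : Fin 3 → F` be injective.  There are `c, J₀ ∈ ℤ` such that for all `J ≥ J₀`, all `k ∈ GL₃(𝒪)` and all `P` with `P₂₀ = P₂₁ = 0`: if
`k P k⁻¹ − diag(d) ∈ M₃(𝔭^J)` entrywise then **some row `a` of `k` has `k_{a0}, k_{a1} ∈ 𝔭^{J−c}`** (`a` = the unit index of the last row `w` of `k⁻¹`:
`w_i(d_i − P₂₂) ∈ 𝔭^J`, so `|d_a − P₂₂| ≤ ρ^J < min_{i≠j}|d_i − d_j|`, `|d_i − P₂₂| = |d_i − d_a|` and `w_i ∈ 𝔭^{J−c}` for `i ≠ a`; then `k_{al} = −w_a⁻¹ Σ_{i≠a} w_i k_{il}`).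
[cite: HarishChandra1999AdmissibleDistributions, §7 Lemma 7.8] [cite: BushnellHenniart2006, §1.1] -/
theorem exists_level_of_conj_mem_box_diagonal (d : Fin 3 → F) (hd : Function.Injective d) :
    ∃ c J₀ : ℤ, ∀ J : ℤ, J₀ ≤ J → ∀ k : GL (Fin 3) F, k ∈ glInt 3 F → ∀ P : Matrix (Fin 3) (Fin 3) F, P 2 0 = 0 → P 2 1 = 0 →
      (∀ i l, ((k : Matrix (Fin 3) (Fin 3) F) * P * ((k⁻¹ : GL (Fin 3) F) : Matrix (Fin 3) (Fin 3) F) - Matrix.diagonal d) i l ∈ primePowBall F J) →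
        ∃ a : Fin 3, (k : Matrix (Fin 3) (Fin 3) F) a 0 ∈ primePowBall F (J - c) ∧ (k : Matrix (Fin 3) (Fin 3) F) a 1 ∈ primePowBall F (J - c) := by
  classical
  set ρ : ℝ≥0 := (residueFieldCard F : ℝ≥0)⁻¹ with hρ
  have hρ0 : 0 < ρ := inv_residueFieldCard_pos
  have hρ1 : ρ < 1 := inv_residueFieldCard_lt_one
  -- the separation `γ = min_{i ≠ j} |d_i − d_j| > 0`
  set γ : ℝ≥0 := min (min (normAbs F (d 0 - d 1)) (normAbs F (d 0 - d 2))) (normAbs F (d 1 - d 2)) with hγ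
  have hne : ∀ {i j : Fin 3}, i ≠ j → 0 < normAbs F (d i - d j) := fun hij =>
    pos_iff_ne_zero.2 fun h => hij (hd (sub_eq_zero.1 ((map_eq_zero (normAbs F)).1 h)))
  have hγ0 : 0 < γ := lt_min (lt_min (hne (by decide)) (hne (by decide))) (hne (by decide))
  have hγle : ∀ i j : Fin 3, i ≠ j → γ ≤ normAbs F (d i - d j) := fun i j hij => by
    fin_cases i <;> fin_cases j
    all_goals first | exact absurd rfl hij | skip
    · exact (min_le_left _ _).trans (min_le_left _ _)
    · exact (min_le_left _ _).trans (min_le_right _ _)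
    · rw [← normAbs_neg, neg_sub]; exact (min_le_left _ _).trans (min_le_left _ _)
    · exact min_le_right _ _
    · rw [← normAbs_neg, neg_sub]; exact (min_le_left _ _).trans (min_le_right _ _)
    · rw [← normAbs_neg, neg_sub]; exact min_le_right _ _
  -- the level shift `c`: `γ⁻¹ ≤ ρ^{-c}`, i.e. `ρ^c ≤ γ`
  obtain ⟨c, hc⟩ := exists_le_zpow_neg (F := F) γ⁻¹
  have hρc : ρ ^ (c : ℤ) ≤ γ := by
    rw [zpow_neg] at hc
    exact (inv_le_inv₀ hγ0 (zpow_pos hρ0 _)).1 hc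
  refine ⟨(c : ℤ), (c : ℤ) + 1, fun J hJ k hk P hP20 hP21 hX => ?_⟩
  have hρJ : ρ ^ J < γ := lt_of_lt_of_le ((zpow_right_strictAnti₀ hρ0 hρ1) (show (c : ℤ) < J by omega)) hρc
  set Q : Matrix (Fin 3) (Fin 3) F := ((k⁻¹ : GL (Fin 3) F) : Matrix (Fin 3) (Fin 3) F) with hQ
  set K : Matrix (Fin 3) (Fin 3) F := (k : Matrix (Fin 3) (Fin 3) F) with hK
  set t : F := P 2 2 with ht
  -- (II) for the diagonal centre: `w_j (d_j − t) ∈ 𝔭^J`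
  have hII : ∀ j : Fin 3, Q 2 j * (d j - t) ∈ primePowBall F J := fun j => by
    have h := sum_invRow_mul_sub_mem_primePowBall hk hP20 hP21 (Matrix.diagonal d) hX j
    simp only [Matrix.diagonal_apply, mul_ite, mul_zero, Finset.sum_ite_eq', Finset.mem_univ, if_true] at h
    convert h using 1
    ring
  -- the unit index `a`: `|d_a − t| ≤ ρ^J`, hence `|d_i − t| = |d_i − d_a| ≥ γ` and `w_i ∈ 𝔭^{J−c}` for `i ≠ a`
  obtain ⟨a, ha⟩ := exists_normAbs_invRow_eq_one hk
  have hda : normAbs F (d a - t) ≤ ρ ^ J := by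
    have h := (mem_primePowBall_iff).1 (hII a)
    rwa [map_mul, ha, one_mul] at h
  have hwi : ∀ i : Fin 3, i ≠ a → Q 2 i ∈ primePowBall F (J - c) := fun i hia => by
    have hdi : normAbs F (d i - t) = normAbs F (d i - d a) := by
      rw [show d i - t = (d i - d a) + (d a - t) by ring]
      exact normAbs_add_eq_of_lt (lt_of_le_of_lt hda (lt_of_lt_of_le hρJ (hγle i a hia)))
    have hγi : γ ≤ normAbs F (d i - t) := hdi ▸ hγle i a hia
    have h1 : normAbs F (Q 2 i) * γ ≤ ρ ^ J :=
      calc normAbs F (Q 2 i) * γ ≤ normAbs F (Q 2 i) * normAbs F (d i - t) := mul_le_mul_of_nonneg_left hγi zero_le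
        _ = normAbs F (Q 2 i * (d i - t)) := by rw [map_mul]
        _ ≤ ρ ^ J := (mem_primePowBall_iff).1 (hII i)
    refine (mem_primePowBall_iff).2 (((le_div_iff₀ hγ0).2 h1).trans ?_)
    calc ρ ^ J / γ = ρ ^ J * γ⁻¹ := div_eq_mul_inv _ _
      _ ≤ ρ ^ J * ρ ^ (-(c : ℤ)) := mul_le_mul_of_nonneg_left hc zero_le
      _ = ρ ^ (J - c) := by rw [← zpow_add₀ hρ0.ne', ← sub_eq_add_neg]
  -- (IV) on row `a`: `w_a k_{al} = −Σ_{i ≠ a} w_i k_{il} ∈ 𝔭^{J−c}`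
  have hcol : ∀ l : Fin 3, l ≠ 2 → K a l ∈ primePowBall F (J - c) := fun l hl => by
    have h := sum_invRow_mul_col_eq_zero k hl
    rw [← Finset.add_sum_erase Finset.univ _ (Finset.mem_univ a)] at h
    have h2 : Q 2 a * K a l = -∑ i ∈ Finset.univ.erase a, Q 2 i * K i l := eq_neg_of_add_eq_zero_left h
    have hmem : Q 2 a * K a l ∈ primePowBall F (J - c) := by
      rw [h2]
      refine neg_mem_primePowBall (sum_mem_primePowBall _ fun i hi => ?_)
      have h := mul_mem_primePowBall (hwi i (Finset.ne_of_mem_erase hi))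
        ((mem_primePowBall_iff).2 ((zpow_zero ((residueFieldCard F : ℝ≥0)⁻¹)).symm ▸ (normAbs_apply_le_one_of_mem_glInt hk i l).1))
      rwa [add_zero] at h
    have hN := (mem_primePowBall_iff).1 hmem
    rw [map_mul, ha, one_mul] at hN
    exact (mem_primePowBall_iff).2 hN
  exact ⟨a, hcol 0 (by decide), hcol 1 (by decide)⟩

end Summit.HodgeConjecture.HodgeConjecture.Cruxes.H413.K2E3GL3ParabolicFibreExhaustion

end
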